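import Literature.Geometry.Lorentzian.HarmonicAsymptotics
import Literature.Geometry.Lorentzian.ExteriorRegion
import HarnessLib

/-!
# Proofs about the mass-inequality facts: the time-symmetric case as a corollary

This file (theorems only; sibling of `Literature.Geometry.Lorentzian.MassInequalities`) starts
the discharge programme of the named fact `Literature.Geometry.Lorentzian.positive_mass_theorem_riemannian`
(Riemannian positive mass theorem, `E ≥ 0` for complete one-ended asymptotically flat
time-symmetric data with `R(h) ≥ 0`; the time-symmetric case of Eichmair–Huang–Lee–Schoen,
J. Eur. Math. Soc. 18 (2016), Thm. 1).

## Content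

* `momentumDensity_eq_zero_of_isTimeSymmetric`, `energyDensity_of_isTimeSymmetric`,
  `satisfiesDominantEnergyCondition_iff_of_isTimeSymmetric`: for `k = 0` one has `J = 0`,
  `μ = R(h)/(16π)`, and the dominant energy condition `|J|_h ≤ μ` is equivalent to `R(h) ≥ 0`
  (EHLS 2016, p. 2: "In this case, we have `P = 0`, and the dominant energy condition reduces to
  the assumption of nonnegative scalar curvature of `g`").
* `positive_mass_theorem_riemannian_of_spacetime`: the named fact
  `positive_mass_theorem_spacetime` (`|P| ≤ E`, EHLS Thm. 1 for `n = 3`) implies the named fact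
  `positive_mass_theorem_riemannian` (`0 ≤ E`). This is the first (trivial) layer of the proof
  architecture of EHLS: the paper proves Thm. 1 for general `k` and obtains the Riemannian
  statement as the special case `k ≡ 0`; the ADM momentum fluxes of time-symmetric data vanish
  (`AFEnd.hasADMMomentum_zero_of_isTimeSymmetric`), so the momentum limits exist and
  `0 ≤ |P| ≤ E`.

* *The remaining layers of the EHLS architecture* live in
  `Literature.Geometry.Lorentzian.HarmonicAsymptotics`: the density theorem (EHLS Thm. 18) is
  the named fact `EichmairHuangLeeSchoen_densityTheorem` there, and the reduction
  `positive_mass_theorem_spacetime_of_density` — the density theorem together with Thm. 1 *for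
  data with harmonic asymptotics and the strict dominant energy condition* (the case §§3–4 prove
  via marginally outer trapped surfaces and the Gauss–Bonnet theorem) imply
  `positive_mass_theorem_spacetime` — is proved. That harmonic-asymptotics case is Thm. 1 itself
  on a dense subclass of its data, with no separate locator and no smaller published pieces, so
  it is *not* vendored as a named fact of its own (it would only duplicate the debt
  `positive_mass_theorem_spacetime`; D-0026 review, 2026-08-15): it is the explicit hypothesis
  of that reduction, and the one-line composition with `positive_mass_theorem_riemannian_of_spacetime`
  formerly recorded here as `positive_mass_theorem_riemannian_of_density` is withdrawn with it.
  The EHLS trust base of `positive_mass_theorem_riemannian` is thus {EHLS Thm. 1 (n = 3)} =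
  {`positive_mass_theorem_spacetime`}, or {EHLS Thm. 18, EHLS Thm. 1 on harmonic data} through the
  reduction.

* `positive_mass_theorem_riemannian_of_exteriorRegion`: a second, independent reduction — the
  two Huisken–Ilmanen named facts of `Literature.Geometry.Lorentzian.ExteriorRegion` (Lemma 4.1
  (i), `exteriorRegion_structure`, and the Main Theorem for exterior regions,
  `riemannian_penrose_inequality_exteriorRegion`, whose first conclusion is `m ≥ 0`; J.
  Differential Geom. 59 (2001), §8, Proof of Main Theorem, step 1: *"Let `M` be an exterior
  region satisfying (0.1). If `M` has no boundary, then by Lemma 7.4, the solution given in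
  Lemma 8.1 proves `m_ADM(M) ≥ 0`"* — the inverse mean curvature flow proof of the Riemannian
  positive mass theorem, independent of the minimal-surface and spinor proofs) imply
  `positive_mass_theorem_riemannian`: the whole one-ended manifold is an exterior region of `e`
  with empty minimal boundary (`MinimalBoundary.univ`), Lemma 4.1 (i) cuts out the trapped set
  and leaves the exterior region `U = X ∖ K(X)` of the end with compact minimal boundary and no
  other compact minimal surfaces, and the Main Theorem applied to `U` gives `0 ≤ E`. The source
  decay hypothesis `HasSourceDecay` of the fact is not used on this path (Huisken–Ilmanen need
  only (0.1), implied by asymptotic flatness of order `1`). So `positive_mass_theorem_riemannian`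
  is discharged by whichever of the leaves {EHLS Thm. 1 (n = 3), i.e.
  `positive_mass_theorem_spacetime`}, {HI Lemma 4.1 (i), HI Main Theorem} is proved first; no
  further decomposition of the fact is needed or intended (D-0026).

## References

* M. Eichmair, L.-H. Huang, D. A. Lee, R. Schoen, *The spacetime positive mass theorem in
  dimensions less than eight*, J. Eur. Math. Soc. 18 (2016) 83–121 (arXiv:1110.2087): Thm. 1
  and p. 2 (time-symmetric case), §2 Def. 3.
* G. Huisken, T. Ilmanen, *The inverse mean curvature flow and the Riemannian Penrose
  inequality*, J. Differential Geom. 59 (2001) 353–437: §0 Main Theorem (`m ≥ 0` and (0.3)),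
  §4 Lemma 4.1 (i), §8 Lemma 8.1 and Proof of Main Theorem, step 1 (the no-boundary case).
-/

noncomputable section

open Bundle Set Manifold TopologicalSpace Filter MeasureTheory Asymptotics
open scoped ContDiff Topology ENNReal Manifold Real

namespace Literature.Geometry.Lorentzian


variable {X : Type} [TopologicalSpace X] [ChartedSpace E3 X] [IsManifold (𝓡 3) ∞ X]

/-- For **time-symmetric** data (`k = 0`) the momentum density vanishes identically:
`J = (div_h k - d(tr_h k))/(8π) = 0` (`IsTimeSymmetric.momentumConstraintFn_eq_zero`).
Eichmair–Huang–Lee–Schoen, J. Eur. Math. Soc. 18 (2016), p. 2 ("in this case we have `P = 0`,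
and the dominant energy condition reduces to the assumption of nonnegative scalar curvature")
and Def. 3 (`J = div_g k - d(tr_g k)`). [cite: EichmairHuangLeeSchoen2016, p. 2 and §2 Def. 3] -/
theorem momentumDensity_eq_zero_of_isTimeSymmetric {D : InitialDataSet (𝓡 3) X}
    [D.metric.HasLeviCivita] (hts : D.IsTimeSymmetric) (x : X) :
    D.momentumDensity x = 0 := by
  simp [InitialDataSet.momentumDensity, hts.momentumConstraintFn_eq_zero]

/-- For **time-symmetric** data (`k = 0`) the energy density is `μ = R(h)/(16π)`
(`μ = (R - |k|² + (tr k)²)/(16π)` with `k = 0`). Eichmair–Huang–Lee–Schoen 2016, p. 2 and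
Def. 3 (`μ = ½ (R_g - |k|²_g + (tr_g k)²)`, a positive multiple of ours).
[cite: EichmairHuangLeeSchoen2016, p. 2 and §2 Def. 3] -/
theorem energyDensity_of_isTimeSymmetric {D : InitialDataSet (𝓡 3) X}
    [D.metric.HasLeviCivita] (hts : D.IsTimeSymmetric) (x : X) :
    D.energyDensity x = D.metric.scalarCurvature x / (16 * Real.pi) := by
  simp [InitialDataSet.energyDensity, InitialDataSet.hamiltonianConstraintFn,
    hts.normSqK_eq_zero, hts.isMaximalData x]

/-- For **time-symmetric** data (`k = 0`) the dominant energy condition `|J|_h ≤ μ` is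
equivalent to nonnegative scalar curvature `R(h) ≥ 0` (`J = 0`, `μ = R/(16π)`).
Eichmair–Huang–Lee–Schoen, J. Eur. Math. Soc. 18 (2016), p. 2: "the dominant energy condition
reduces to the assumption of nonnegative scalar curvature of `g`".
[cite: EichmairHuangLeeSchoen2016, p. 2 time-symmetric case] -/
theorem satisfiesDominantEnergyCondition_iff_of_isTimeSymmetric {D : InitialDataSet (𝓡 3) X}
    [D.metric.HasLeviCivita] (hts : D.IsTimeSymmetric) :
    D.SatisfiesDominantEnergyCondition ↔ ∀ x : X, 0 ≤ D.metric.scalarCurvature x := by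
  refine forall_congr' fun x ↦ ?_
  rw [momentumDensity_eq_zero_of_isTimeSymmetric hts x, energyDensity_of_isTimeSymmetric hts x]
  simp only [PseudoRiemannianMetric.innerDual, LinearMap.zero_apply, Real.sqrt_zero]
  rw [le_div_iff₀ (by positivity), zero_mul]

/-- **The Riemannian positive mass theorem is the time-symmetric case of the spacetime
positive mass theorem** (first reduction step of the proof architecture of
Eichmair–Huang–Lee–Schoen, J. Eur. Math. Soc. 18 (2016), Thm. 1, as stated on p. 2: for
`k ≡ 0` one has `P = 0` and the dominant energy condition is `R ≥ 0`, so `E ≥ |P|` reads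
`E ≥ 0`). Formally: the named fact `positive_mass_theorem_spacetime` implies the named fact
`positive_mass_theorem_riemannian` — time-symmetric data with `R(h) ≥ 0` satisfy the dominant
energy condition (`satisfiesDominantEnergyCondition_iff_of_isTimeSymmetric`), their ADM momentum
fluxes vanish so the momentum limits exist (`AFEnd.hasADMMomentum_zero_of_isTimeSymmetric`),
and `0 ≤ |P| ≤ E`. [cite: EichmairHuangLeeSchoen2016, Thm. 1 with p. 2 (time-symmetric case)] -/
theorem positive_mass_theorem_riemannian_of_spacetime (h : positive_mass_theorem_spacetime) :
    positive_mass_theorem_riemannian := by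
  intro X _ _ _ _ _ _ D _ e hts hAF hsrc hsole hcompl hR hE
  have hdec : D.SatisfiesDominantEnergyCondition :=
    (satisfiesDominantEnergyCondition_iff_of_isTimeSymmetric hts).2 hR
  have hP : ∀ i, ∃ p, e.HasADMMomentum D i p :=
    fun i ↦ ⟨0, e.hasADMMomentum_zero_of_isTimeSymmetric hts i⟩
  exact (Real.sqrt_nonneg _).trans (h X D e hdec hAF hsrc hsole hcompl hE hP)

/-- **The Riemannian positive mass theorem from the two Huisken–Ilmanen named facts** (a second
reduction, independent in print of the Eichmair–Huang–Lee–Schoen one): Lemma 4.1 (i)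
(`exteriorRegion_structure`) and the Main Theorem for exterior regions
(`riemannian_penrose_inequality_exteriorRegion`, first conclusion `m ≥ 0`) of Huisken–Ilmanen,
J. Differential Geom. 59 (2001), imply `positive_mass_theorem_riemannian`. Proof (§8, Proof of
Main Theorem, step 1, the no-boundary case, with §4): for complete one-ended data the whole
manifold `⊤` is an exterior region of the end `e` (`⊤` is connected, contains `e.far R'`, and
`closure ⊤ ∖ e.far R' = (e.far R')ᶜ` is compact by `IsSoleEnd`) with *empty* minimal boundary
(`MinimalBoundary.univ`); Lemma 4.1 (i) yields the exterior region `U = X ∖ K(X)` of the end,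
with compact minimal boundary `B` and no compact minimal surface in `closure U` off `∂U`
(`subset_frontier_of_isMinimalSurfaceImage`); the Main Theorem for `U` (scalar curvature
`≥ 0` on `closure U`, metric decay `h - δ = O₂(r⁻¹)` giving (0.1), the ADM flux limit existing)
gives `0 ≤ m = E`. The hypotheses `k = 0` and `HasSourceDecay` of the fact are not needed on
this path. [cite: HuiskenIlmanenIMCF2001, Main Theorem (m ≥ 0), Lemma 4.1 (i) and §8 Proof of Main Theorem step 1] -/
theorem positive_mass_theorem_riemannian_of_exteriorRegion (h1 : exteriorRegion_structure)
    (h2 : riemannian_penrose_inequality_exteriorRegion) : positive_mass_theorem_riemannian := by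
  intro X _ _ _ _ _ _ D _ e _hts hAF _hsrc hsole hcompl hR hE
  -- the whole one-ended manifold is an exterior region of `e`, with empty minimal boundary
  have htop : IsExteriorRegion e ⊤ := by
    obtain ⟨R', hR', hK⟩ := hsole
    refine ⟨?_, R', hR', fun x _ ↦ ?_, ?_⟩
    · rw [Opens.coe_top]
      exact isConnected_univ
    · simp
    · rwa [Opens.coe_top, closure_univ, ← Set.compl_eq_univ_sdiff]
  -- Lemma 4.1 (i): the exterior region `U = X ∖ K(X)` of the end and its minimal boundary `B`
  obtain ⟨-, U, B, hUV, hUext, -⟩ := h1 X D e ⊤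
    (MinimalBoundary.ofFrontierEqEmpty D.h (by rw [Opens.coe_top, frontier_univ])) hcompl htop
    hAF.isMetricAsymptoticallyFlat
  -- no other compact minimal surfaces in `closure U`
  have hiii : ∀ N, IsMinimalSurfaceImage D.h N → N ⊆ closure (U : Set X) → N ⊆ range B.f := by
    intro N hN hNU
    rw [← B.frontier_eq]
    exact subset_frontier_of_isMinimalSurfaceImage U.isOpen hUV hN hNU
  -- the Main Theorem for the exterior region `U`: `0 ≤ m`
  exact (h2 X D e U B hcompl hUext hAF.isMetricAsymptoticallyFlat hE (fun x _ ↦ hR x) hiii).1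

end Literature.Geometry.Lorentzian

end
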